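import Literature.NumberTheory.EllipticCurves.SecondKindColmezFunctional
import Literature.NumberTheory.PAdicHodge.FormalGroupDivisionSaturation
import HarnessLib

/-!
# Transport invariance of the Colmez functional: if an EXACT `[p]_W`-division tower `w` is `δ`-close (`δ < 1`) to an
# arbitrary sequence `u` of `𝔪_K`, then `pᵐ·G(u_m) − pᵐ·G(w_m) → 0` for every series `G` of the second kind for `F_W`

Topic `Literature/NumberTheory/EllipticCurves`; namespace `Literature.NumberTheory.EllipticCurves`. THEOREMS ONLY (no definition, no named
fact, no instance, no `sorry`). Setting as in `SecondKindSeriesValueCocycle` (J1) and `SecondKindColmezFunctional` (J2): `K` complete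
nontrivially normed ultrametric, `W/ℤ`, `G = Σ cₙXⁿ ∈ K⟦X⟧` with `c₀ = 0`, `‖cₙ‖ ≤ n^k` and `F_W`-coboundary coefficients of norm `≤ C`;
`G(x) := Σ' cₙxⁿ` (`‖x‖ < 1`); `[p] = [p]_W` acting on `𝔪_K` by `evalPt₁`.

* §1 LIPSCHITZ ON CLOSED BALLS: `‖x^{n+1} − y^{n+1}‖ ≤ ρⁿ‖x − y‖` for `‖x‖, ‖y‖ ≤ ρ` (`norm_pow_succ_sub_pow_succ_le`), a uniform bound
  `n^k ρⁿ ≤ B` (`exists_pow_mul_pow_le`), and ★ `exists_norm_tsum_sub_tsum_le`: **`‖G(x) − G(y)‖ ≤ L_ρ·‖x − y‖` on `‖x‖, ‖y‖ ≤ ρ < 1`**.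
  (There is NO uniform Lipschitz constant on all of `𝔪_K` — the coefficients `cₙ` are unbounded — which is why the transport below is a
  diagonal argument and not a termwise comparison: along a division tower `‖w_m‖ → 1`.)
* §2 `norm_tsum_iterate_formalMul_sub_pow_mul_le`: **`‖G([p]ʲx) − pʲ·G(x)‖ ≤ C`** (iterate of J2's `‖G([p]x) − p·G(x)‖ ≤ C`).
* §3 TRANSPORT: for an exact tower `w` (`[p]w_{n+1} = w_n`) and any `u` with `‖w_n − u_n‖ ≤ δ < 1`: `[p]ʲ(w_{n+j}) = w_n`
  (`iterate_formalMul_divisionSeq`), `‖[p]ʲ(u_{n+j}) − w_n‖ ≤ ρʲδ` with `ρ = max(‖p‖, δ^{p−1}) < 1` (`norm_iterate_formalMul_sub_divisionSeq_le`,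
  from `FormalGroupDivisionSaturation.norm_iterate_formalMul_sub_le`), the KEY ESTIMATE
  `‖p^{n+j}G(u_{n+j}) − p^{n+j}G(w_{n+j})‖ ≤ ‖p‖ⁿ·max(C, L_n·ρʲ·δ)` (`norm_pow_mul_tsum_sub_pow_mul_tsum_le`), and
  ★★ `tendsto_pow_mul_tsum_sub_pow_mul_tsum` (**`pᵐG(u_m) − pᵐG(w_m) → 0`** when `‖p‖ < 1`), ★★ `tendsto_pow_mul_tsum_of_divisionSeq_norm_sub_le`
  (**the Colmez functional of `G` along `w` is also `lim pᵐG(u_m)`**), `exists_tendsto_pow_mul_tsum_of_divisionSeq_norm_sub_le` (with J2's rate).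
* §4 Two evaluations used by (HL-eval): `pow_mul_tsum_divisionSeq_eq_of_cocycle_zero` (`C = 0`, e.g. `G = log_W`: `pⁿG(wₙ) = G(w₀)`) and
  `tendsto_pow_mul_tsum_zero_of_norm_coeff_le` (BOUNDED coefficients `‖cₙ‖ ≤ B` ⇒ `pᵐG(u_m) → 0` along any sequence in `𝔪_K`).

Purpose (crux K★ `stmt-BirchSwinnertonDyer-22226`, line `kato_lever`, memo `Lines/kato-lever-K2-ramified-cm-transport.md` §9, step J3): in the
«CM-fibre transport» a `[p]_{W_D}`-division tower `u` of the ramified good model is replaced by the unique `‖ϖ‖`-close exact `[p]_{E₀}`-tower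
`w = Tu` (`AinfRamifiedDivisionTransport`); this file shows that the Colmez functional `𝒞_w(G) = lim pⁿG(wₙ)` of J2 can be computed along `u`
itself, which is what (HL-eval) `log_{W_D}(u₀) = A·𝒞_{Tu}(log_{E₀}) + B·𝒞_{Tu}(log_{E₀}(Xᵖ))` needs. Infrastructure only; BSD / K★ are not
proved by any of this; nothing about elliptic curves over number fields is proved here.

## References
* N. M. Katz, *Crystalline cohomology, Dieudonné modules, and Jacobi sums* (1981), §5.1, Key Lemma 5.1.3, Thm. 5.1.4. [Katz1981CrystallineDieudonne]
* P. Colmez, *Périodes p-adiques des variétés abéliennes*, Math. Ann. 292 (1992), §2 (the period functional; not cited as a key).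
* J. H. Silverman, *The Arithmetic of Elliptic Curves* (2009), IV.2.3, IV.4.4, Thm. IV.6.4. [SilvermanAEC2009]
-/

noncomputable section

open scoped Classical Topology
open PowerSeries Filter Finset

namespace Literature.NumberTheory.EllipticCurves

open Literature.NumberTheory.GaloisRepresentations.LubinTate Literature.NumberTheory.PAdicHodge

variable {K : Type*} [NontriviallyNormedField K] [IsUltrametricDist K] [CompleteSpace K]

/-! ## §1 Lipschitz bound for `x ↦ G(x)` on closed balls of radius `ρ < 1` -/

omit [IsUltrametricDist K] [CompleteSpace K] in
/-- **`n^k·ρⁿ` is bounded** for `0 ≤ ρ < 1` (it tends to `0`). [cite: SilvermanAEC2009, IV.6.4] -/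
theorem exists_pow_mul_pow_le (k : ℕ) {ρ : ℝ} (hρ0 : 0 ≤ ρ) (hρ1 : ρ < 1) :
    ∃ B : ℝ, 0 ≤ B ∧ ∀ n : ℕ, (n : ℝ) ^ k * ρ ^ n ≤ B := by
  have h := tendsto_pow_const_mul_const_pow_of_abs_lt_one k (r := ρ) (by rwa [abs_of_nonneg hρ0])
  obtain ⟨B, hB⟩ := h.bddAbove_range
  refine ⟨max B 0, le_max_right _ _, fun n => (hB ⟨n, rfl⟩).trans (le_max_left _ _)⟩

omit [CompleteSpace K] in
/-- **`‖x^{n+1} − y^{n+1}‖ ≤ ρⁿ·‖x − y‖`** for `‖x‖, ‖y‖ ≤ ρ` (`x^{n+1} − y^{n+1} = (x − y)·Σ xⁱyⁿ⁻ⁱ`, ultrametric sum).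
[cite: SilvermanAEC2009, IV.2.3] -/
theorem norm_pow_succ_sub_pow_succ_le {x y : K} {ρ : ℝ} (hx : ‖x‖ ≤ ρ) (hy : ‖y‖ ≤ ρ) (n : ℕ) :
    ‖x ^ (n + 1) - y ^ (n + 1)‖ ≤ ρ ^ n * ‖x - y‖ := by
  have hρ0 : 0 ≤ ρ := (norm_nonneg _).trans hx
  rw [← geom_sum₂_mul, norm_mul]
  refine mul_le_mul_of_nonneg_right ?_ (norm_nonneg _)
  refine IsUltrametricDist.norm_sum_le_of_forall_le_of_nonneg (pow_nonneg hρ0 n) fun i hi => ?_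
  have hi' : i ≤ n := by have := mem_range.mp hi; omega
  rw [norm_mul, norm_pow, norm_pow, show n + 1 - 1 - i = n - i by omega]
  calc ‖x‖ ^ i * ‖y‖ ^ (n - i) ≤ ρ ^ i * ρ ^ (n - i) :=
        mul_le_mul (pow_le_pow_left₀ (norm_nonneg _) hx i) (pow_le_pow_left₀ (norm_nonneg _) hy _) (pow_nonneg (norm_nonneg _) _)
          (pow_nonneg hρ0 _)
    _ = ρ ^ n := by rw [← pow_add, Nat.add_sub_cancel' hi']

omit [IsUltrametricDist K] in
/-- Summability of `Σ cₙxⁿ` for `‖cₙ‖ ≤ n^k` and `‖x‖ < 1`. [cite: SilvermanAEC2009, IV.6.4] -/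
theorem summable_coeff_mul_pow_of_norm_coeff_le_pow (G : PowerSeries K) (k : ℕ) (hk : ∀ n, ‖PowerSeries.coeff n G‖ ≤ (n : ℝ) ^ k) {x : K} (hx : ‖x‖ < 1) :
    Summable fun n : ℕ => PowerSeries.coeff n G * x ^ n := by
  have hg := summable_pow_mul_geometric_of_norm_lt_one k (show ‖(‖x‖ : ℝ)‖ < 1 by rwa [norm_norm])
  refine Summable.of_norm_bounded hg fun n => ?_
  rw [norm_mul, norm_pow]
  exact mul_le_mul_of_nonneg_right (hk n) (pow_nonneg (norm_nonneg x) n)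

/-- ★ **Lipschitz bound on closed balls**: for `‖cₙ‖ ≤ n^k` and `0 < ρ < 1` there is `L ≥ 0` with
**`‖G(x) − G(y)‖ ≤ L·‖x − y‖` whenever `‖x‖, ‖y‖ ≤ ρ`** (`L = B/ρ` with `n^kρⁿ ≤ B`; termwise `‖cₙ‖·‖xⁿ − yⁿ‖ ≤ n^kρⁿ⁻¹‖x − y‖`).
[cite: Katz1981CrystallineDieudonne, §5.1] [cite: SilvermanAEC2009, IV.6.4] -/
theorem exists_norm_tsum_sub_tsum_le (G : PowerSeries K) (k : ℕ) (hk : ∀ n, ‖PowerSeries.coeff n G‖ ≤ (n : ℝ) ^ k)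
    {ρ : ℝ} (hρ0 : 0 < ρ) (hρ1 : ρ < 1) :
    ∃ L : ℝ, 0 ≤ L ∧ ∀ x y : K, ‖x‖ ≤ ρ → ‖y‖ ≤ ρ →
      ‖∑' n : ℕ, PowerSeries.coeff n G * x ^ n - ∑' n : ℕ, PowerSeries.coeff n G * y ^ n‖ ≤ L * ‖x - y‖ := by
  obtain ⟨B, hB0, hB⟩ := exists_pow_mul_pow_le k hρ0.le hρ1
  refine ⟨B / ρ, div_nonneg hB0 hρ0.le, fun x y hx hy => ?_⟩
  have hx1 : ‖x‖ < 1 := hx.trans_lt hρ1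
  have hy1 : ‖y‖ < 1 := hy.trans_lt hρ1
  rw [← (summable_coeff_mul_pow_of_norm_coeff_le_pow G k hk hx1).tsum_sub (summable_coeff_mul_pow_of_norm_coeff_le_pow G k hk hy1)]
  refine IsUltrametricDist.norm_tsum_le_of_forall_le_of_nonneg (mul_nonneg (div_nonneg hB0 hρ0.le) (norm_nonneg _)) fun n => ?_
  rw [← mul_sub, norm_mul]
  rcases Nat.eq_zero_or_pos n with rfl | hn
  · rw [pow_zero, pow_zero, sub_self, norm_zero, mul_zero]
    exact mul_nonneg (div_nonneg hB0 hρ0.le) (norm_nonneg _)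
  · obtain ⟨m, rfl⟩ := Nat.exists_eq_add_of_le' hn
    calc ‖PowerSeries.coeff (m + 1) G‖ * ‖x ^ (m + 1) - y ^ (m + 1)‖
        ≤ ((m + 1 : ℕ) : ℝ) ^ k * (ρ ^ m * ‖x - y‖) :=
          mul_le_mul (hk (m + 1)) (norm_pow_succ_sub_pow_succ_le hx hy m) (norm_nonneg _) (by positivity)
      _ = ((m + 1 : ℕ) : ℝ) ^ k * ρ ^ (m + 1) / ρ * ‖x - y‖ := by
          rw [pow_succ]; field_simp
      _ ≤ B / ρ * ‖x - y‖ := by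
          refine mul_le_mul_of_nonneg_right (div_le_div_of_nonneg_right (hB (m + 1)) hρ0.le) (norm_nonneg _)

/-! ## §2 `G([p]ʲx) ≡ pʲ·G(x)` up to `C` -/

/-- **`‖G([p]ʲ x) − pʲ·G(x)‖ ≤ C`** for every `j` and `x ∈ 𝔪_K` (induction on `j` with J2's `‖G([p]z) − p·G(z)‖ ≤ C` at `z = [p]ʲx`
and `‖p‖ ≤ 1`). [cite: Katz1981CrystallineDieudonne, §5.1, Key Lemma 5.1.3] -/
theorem norm_tsum_iterate_formalMul_sub_pow_mul_le (W : WeierstrassCurve ℤ) (G : PowerSeries K) (hG0 : PowerSeries.constantCoeff G = 0)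
    (k : ℕ) (hk : ∀ n, ‖PowerSeries.coeff n G‖ ≤ (n : ℝ) ^ k) {C : ℝ} (hC0 : 0 ≤ C)
    (hC : ∀ d : Fin 2 →₀ ℕ, ‖MvPowerSeries.coeff d (G.subst (W.map (Int.castRingHom K)).formalGroupLaw -
      G.subst (MvPowerSeries.X 0 : MvPowerSeries (Fin 2) K) - G.subst (MvPowerSeries.X 1 : MvPowerSeries (Fin 2) K))‖ ≤ C)
    {p : ℕ} (hp : 1 ≤ p) (x : (ballNilIdeal K).toIdeal) (j : ℕ) :
    ‖∑' m : ℕ, PowerSeries.coeff m G *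
          ((((evalPt₁ (ballNilIdeal K) (W.formalMul p) (W.constantCoeff_formalMul p))^[j] x : (ballNilIdeal K).toIdeal) :
            unitBall K) : K) ^ m -
        (p : K) ^ j * ∑' m : ℕ, PowerSeries.coeff m G * ((x : unitBall K) : K) ^ m‖ ≤ C := by
  have hp1 : ‖(p : K)‖ ≤ 1 := IsUltrametricDist.norm_natCast_le_one K p
  induction j with
  | zero => rw [Function.iterate_zero_apply, pow_zero, one_mul, sub_self, norm_zero]; exact hC0
  | succ j ih =>
    set z := (evalPt₁ (ballNilIdeal K) (W.formalMul p) (W.constantCoeff_formalMul p))^[j] x with hz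
    rw [Function.iterate_succ_apply', ← hz]
    have hstep := norm_tsum_formalMul_sub_nsmul_le W G hG0 k hk hC0 hC z hp
    have hsplit : ∀ a b c : K, a - (p : K) ^ (j + 1) * c = (a - (p : K) * b) + (p : K) * (b - (p : K) ^ j * c) :=
      fun a b c => by ring
    rw [hsplit _ (∑' m : ℕ, PowerSeries.coeff m G * ((z : unitBall K) : K) ^ m)]
    refine (IsUltrametricDist.norm_add_le_max _ _).trans (max_le hstep ?_)
    rw [norm_mul]
    calc ‖(p : K)‖ * _ ≤ 1 * C := mul_le_mul hp1 ih (norm_nonneg _) zero_le_one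
      _ = C := one_mul C

/-! ## §3 Transport of the Colmez functional along a `δ`-close exact tower -/

section Transport

variable {p : ℕ} [hp : Fact p.Prime]

omit hp in
/-- Along an exact division tower, `[p]ʲ(w_{n+j}) = w_n`. [cite: SilvermanAEC2009, IV.4.4] -/
theorem iterate_formalMul_divisionSeq (W : WeierstrassCurve ℤ) (w : ℕ → (ballNilIdeal K).toIdeal)
    (hw : ∀ n, evalPt₁ (ballNilIdeal K) (W.formalMul p) (W.constantCoeff_formalMul p) (w (n + 1)) = w n) (n j : ℕ) :
    (evalPt₁ (ballNilIdeal K) (W.formalMul p) (W.constantCoeff_formalMul p))^[j] (w (n + j)) = w n := by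
  induction j with
  | zero => rw [Function.iterate_zero_apply, add_zero]
  | succ j ih => rw [Function.iterate_succ_apply, show n + (j + 1) = n + j + 1 by ring, hw, ih]

/-- **`‖[p]ʲ(u_{n+j}) − w_n‖ ≤ ρʲ·δ`**, `ρ = max(‖p‖, δ^{p−1})`, when `w` is an exact `[p]_W`-tower with `‖w_m − u_m‖ ≤ δ` for all `m`
(contraction of `[p]`, `FormalGroupDivisionSaturation.norm_iterate_formalMul_sub_le`, and `[p]ʲ(w_{n+j}) = w_n`); also `≤ δ`.
[cite: SilvermanAEC2009, IV.4.4] [cite: Katz1981CrystallineDieudonne, Thm. 5.1.4] -/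
theorem norm_iterate_formalMul_sub_divisionSeq_le (W : WeierstrassCurve ℤ) {δ : ℝ} (u w : ℕ → (ballNilIdeal K).toIdeal)
    (hw : ∀ n, evalPt₁ (ballNilIdeal K) (W.formalMul p) (W.constantCoeff_formalMul p) (w (n + 1)) = w n)
    (huw : ∀ n, ‖(((w n : (ballNilIdeal K).toIdeal) : unitBall K) : K) - (((u n : (ballNilIdeal K).toIdeal) : unitBall K) : K)‖ ≤ δ)
    (n j : ℕ) :
    ‖((((evalPt₁ (ballNilIdeal K) (W.formalMul p) (W.constantCoeff_formalMul p))^[j] (u (n + j)) : (ballNilIdeal K).toIdeal) :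
          unitBall K) : K) - (((w n : (ballNilIdeal K).toIdeal) : unitBall K) : K)‖ ≤ (max ‖(p : K)‖ (δ ^ (p - 1))) ^ j * δ ∧
    ‖((((evalPt₁ (ballNilIdeal K) (W.formalMul p) (W.constantCoeff_formalMul p))^[j] (u (n + j)) : (ballNilIdeal K).toIdeal) :
          unitBall K) : K) - (((w n : (ballNilIdeal K).toIdeal) : unitBall K) : K)‖ ≤ δ := by
  have hxy : ‖(((u (n + j) : (ballNilIdeal K).toIdeal) : unitBall K) : K) - (((w (n + j) : (ballNilIdeal K).toIdeal) : unitBall K) : K)‖ ≤ δ :=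
    (norm_sub_rev _ _).trans_le (huw (n + j))
  have h := norm_iterate_formalMul_sub_le (K := K) (p := p) (δ := δ) W (u (n + j)) (w (n + j)) hxy j
  rwa [iterate_formalMul_divisionSeq W w hw n j] at h

/-- ★ **KEY ESTIMATE.** For an exact `[p]_W`-tower `w`, a sequence `u` with `‖w_m − u_m‖ ≤ δ < 1`, and `G` of the second kind:
**`‖p^{n+j}·G(u_{n+j}) − p^{n+j}·G(w_{n+j})‖ ≤ ‖p‖ⁿ·max(C, L·ρʲ·δ)`** where `ρ = max(‖p‖, δ^{p−1})` and `L` is ANY Lipschitz constant of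
`x ↦ G(x)` on the closed ball of radius `max(‖w_n‖, δ)` (§1). Proof: `p^{n+j}G(u_{n+j}) − p^{n+j}G(w_{n+j}) =
pⁿ·[(pʲG(u_{n+j}) − G([p]ʲu_{n+j})) + (G([p]ʲu_{n+j}) − G(w_n)) + (G([p]ʲw_{n+j}) − pʲG(w_{n+j}))]` with `[p]ʲw_{n+j} = w_n`; the outer
terms are `≤ C` (§2), the middle one `≤ L·‖[p]ʲu_{n+j} − w_n‖ ≤ L·ρʲδ`. [cite: Katz1981CrystallineDieudonne, §5.1, Thm. 5.1.4] -/
theorem norm_pow_mul_tsum_sub_pow_mul_tsum_le (W : WeierstrassCurve ℤ) (G : PowerSeries K) (hG0 : PowerSeries.constantCoeff G = 0)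
    (k : ℕ) (hk : ∀ n, ‖PowerSeries.coeff n G‖ ≤ (n : ℝ) ^ k) {C : ℝ} (hC0 : 0 ≤ C)
    (hC : ∀ d : Fin 2 →₀ ℕ, ‖MvPowerSeries.coeff d (G.subst (W.map (Int.castRingHom K)).formalGroupLaw -
      G.subst (MvPowerSeries.X 0 : MvPowerSeries (Fin 2) K) - G.subst (MvPowerSeries.X 1 : MvPowerSeries (Fin 2) K))‖ ≤ C)
    {δ : ℝ} (u w : ℕ → (ballNilIdeal K).toIdeal)
    (hw : ∀ n, evalPt₁ (ballNilIdeal K) (W.formalMul p) (W.constantCoeff_formalMul p) (w (n + 1)) = w n)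
    (huw : ∀ n, ‖(((w n : (ballNilIdeal K).toIdeal) : unitBall K) : K) - (((u n : (ballNilIdeal K).toIdeal) : unitBall K) : K)‖ ≤ δ)
    (n : ℕ) {L : ℝ} (hL0 : 0 ≤ L)
    (hL : ∀ x y : K, ‖x‖ ≤ max ‖(((w n : (ballNilIdeal K).toIdeal) : unitBall K) : K)‖ δ →
      ‖y‖ ≤ max ‖(((w n : (ballNilIdeal K).toIdeal) : unitBall K) : K)‖ δ →
      ‖∑' m : ℕ, PowerSeries.coeff m G * x ^ m - ∑' m : ℕ, PowerSeries.coeff m G * y ^ m‖ ≤ L * ‖x - y‖) (j : ℕ) :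
    ‖(p : K) ^ (n + j) * ∑' m : ℕ, PowerSeries.coeff m G * (((u (n + j) : (ballNilIdeal K).toIdeal) : unitBall K) : K) ^ m -
        (p : K) ^ (n + j) * ∑' m : ℕ, PowerSeries.coeff m G * (((w (n + j) : (ballNilIdeal K).toIdeal) : unitBall K) : K) ^ m‖ ≤
      ‖(p : K)‖ ^ n * max C (L * ((max ‖(p : K)‖ (δ ^ (p - 1))) ^ j * δ)) := by
  set P := evalPt₁ (ballNilIdeal K) (W.formalMul p) (W.constantCoeff_formalMul p) with hP
  set Gv : K → K := fun x => ∑' m : ℕ, PowerSeries.coeff m G * x ^ m with hGv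
  set zu : K := (((P^[j] (u (n + j)) : (ballNilIdeal K).toIdeal) : unitBall K) : K) with hzu
  set wn : K := (((w n : (ballNilIdeal K).toIdeal) : unitBall K) : K) with hwn
  have hp1 : 1 ≤ p := hp.out.one_le
  -- the three pieces
  have e1 : ‖Gv zu - (p : K) ^ j * Gv (((u (n + j) : (ballNilIdeal K).toIdeal) : unitBall K) : K)‖ ≤ C :=
    norm_tsum_iterate_formalMul_sub_pow_mul_le W G hG0 k hk hC0 hC hp1 (u (n + j)) j
  have e3 : ‖Gv wn - (p : K) ^ j * Gv (((w (n + j) : (ballNilIdeal K).toIdeal) : unitBall K) : K)‖ ≤ C := by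
    have h := norm_tsum_iterate_formalMul_sub_pow_mul_le W G hG0 k hk hC0 hC hp1 (w (n + j)) j
    rwa [iterate_formalMul_divisionSeq W w hw n j] at h
  obtain ⟨hclose, hcloseδ⟩ := norm_iterate_formalMul_sub_divisionSeq_le W u w hw huw n j
  have e2 : ‖Gv zu - Gv wn‖ ≤ L * ((max ‖(p : K)‖ (δ ^ (p - 1))) ^ j * δ) := by
    refine (hL zu wn ?_ (le_max_left _ _)).trans (mul_le_mul_of_nonneg_left hclose hL0)
    have hsplit : zu = (zu - wn) + wn := by ring
    rw [hsplit]
    exact (IsUltrametricDist.norm_add_le_max _ _).trans (max_le (hcloseδ.trans (le_max_right _ _)) (le_max_left _ _))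
  -- assemble
  have hsplit : (p : K) ^ (n + j) * Gv (((u (n + j) : (ballNilIdeal K).toIdeal) : unitBall K) : K) -
      (p : K) ^ (n + j) * Gv (((w (n + j) : (ballNilIdeal K).toIdeal) : unitBall K) : K) =
      (p : K) ^ n * (-(Gv zu - (p : K) ^ j * Gv (((u (n + j) : (ballNilIdeal K).toIdeal) : unitBall K) : K)) +
        ((Gv zu - Gv wn) + (Gv wn - (p : K) ^ j * Gv (((w (n + j) : (ballNilIdeal K).toIdeal) : unitBall K) : K)))) := by
    ring
  rw [hsplit, norm_mul, norm_pow]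
  refine mul_le_mul_of_nonneg_left ?_ (pow_nonneg (norm_nonneg _) n)
  refine (IsUltrametricDist.norm_add_le_max _ _).trans (max_le ?_ ((IsUltrametricDist.norm_add_le_max _ _).trans (max_le ?_ ?_)))
  · rw [norm_neg]; exact e1.trans (le_max_left _ _)
  · exact e2.trans (le_max_right _ _)
  · exact e3.trans (le_max_left _ _)

/-- ★★ **TRANSPORT INVARIANCE (difference form).** If `‖p‖ < 1` in `K`, `w` is an exact `[p]_W`-division tower and `u` is ANY sequence of
`𝔪_K` with `‖w_m − u_m‖ ≤ δ < 1` for all `m`, then for every series `G` of the second kind for `F_W`: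
**`pᵐ·G(u_m) − pᵐ·G(w_m) → 0`**. (Diagonal argument on the key estimate: first `n` with `‖p‖ⁿC < ε`, then `j` with `‖p‖ⁿ·L_n·ρʲ·δ < ε`.)
[cite: Katz1981CrystallineDieudonne, §5.1, Thm. 5.1.4] -/
theorem tendsto_pow_mul_tsum_sub_pow_mul_tsum (W : WeierstrassCurve ℤ) (G : PowerSeries K) (hG0 : PowerSeries.constantCoeff G = 0)
    (k : ℕ) (hk : ∀ n, ‖PowerSeries.coeff n G‖ ≤ (n : ℝ) ^ k) {C : ℝ} (hC0 : 0 ≤ C)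
    (hC : ∀ d : Fin 2 →₀ ℕ, ‖MvPowerSeries.coeff d (G.subst (W.map (Int.castRingHom K)).formalGroupLaw -
      G.subst (MvPowerSeries.X 0 : MvPowerSeries (Fin 2) K) - G.subst (MvPowerSeries.X 1 : MvPowerSeries (Fin 2) K))‖ ≤ C)
    (hpK : ‖(p : K)‖ < 1) {δ : ℝ} (hδ : δ < 1) (u w : ℕ → (ballNilIdeal K).toIdeal)
    (hw : ∀ n, evalPt₁ (ballNilIdeal K) (W.formalMul p) (W.constantCoeff_formalMul p) (w (n + 1)) = w n)
    (huw : ∀ n, ‖(((w n : (ballNilIdeal K).toIdeal) : unitBall K) : K) - (((u n : (ballNilIdeal K).toIdeal) : unitBall K) : K)‖ ≤ δ) :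
    Tendsto (fun m : ℕ => (p : K) ^ m * ∑' j : ℕ, PowerSeries.coeff j G * (((u m : (ballNilIdeal K).toIdeal) : unitBall K) : K) ^ j -
      (p : K) ^ m * ∑' j : ℕ, PowerSeries.coeff j G * (((w m : (ballNilIdeal K).toIdeal) : unitBall K) : K) ^ j) atTop (𝓝 0) := by
  have hδ0 : 0 ≤ δ := (norm_nonneg _).trans (huw 0)
  set ρ : ℝ := max ‖(p : K)‖ (δ ^ (p - 1)) with hρ
  have hρ0 : 0 ≤ ρ := le_max_of_le_left (norm_nonneg _)
  have hρ1 : ρ < 1 := max_norm_prime_pow_lt_one hpK hδ0 hδ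
  rw [Metric.tendsto_atTop]
  intro ε hε
  -- choose `n` with `‖p‖ⁿ·C < ε`
  have hn : ∃ n : ℕ, ‖(p : K)‖ ^ n * C < ε := by
    have h := (tendsto_pow_atTop_nhds_zero_of_lt_one (norm_nonneg _) hpK).mul_const C
    rw [zero_mul] at h
    obtain ⟨n, hn⟩ := (Metric.tendsto_atTop.1 h) ε hε
    refine ⟨n, ?_⟩
    have := hn n le_rfl
    rwa [Real.dist_eq, sub_zero, abs_of_nonneg (by positivity)] at this
  obtain ⟨n, hnC⟩ := hn
  -- a Lipschitz constant on the ball of radius `r = max(‖w_n‖, δ)` (enlarged to be positive)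
  set r : ℝ := max ‖(((w n : (ballNilIdeal K).toIdeal) : unitBall K) : K)‖ δ with hr
  have hr1 : r < 1 := max_lt (norm_lt_one_of_mem _) hδ
  have hr0 : 0 ≤ r := le_max_of_le_left (norm_nonneg _)
  obtain ⟨L, hL0, hL⟩ := exists_norm_tsum_sub_tsum_le G k hk (ρ := (1 + r) / 2) (by linarith) (by linarith)
  have hL' : ∀ x y : K, ‖x‖ ≤ r → ‖y‖ ≤ r →
      ‖∑' m : ℕ, PowerSeries.coeff m G * x ^ m - ∑' m : ℕ, PowerSeries.coeff m G * y ^ m‖ ≤ L * ‖x - y‖ :=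
    fun x y hx hy => hL x y (hx.trans (by linarith)) (hy.trans (by linarith))
  -- choose `j₀` with `‖p‖ⁿ·L·ρʲ·δ < ε` for `j ≥ j₀`
  have hj : ∃ j₀ : ℕ, ∀ j ≥ j₀, ‖(p : K)‖ ^ n * (L * (ρ ^ j * δ)) < ε := by
    have h := ((tendsto_pow_atTop_nhds_zero_of_lt_one hρ0 hρ1).mul_const δ).const_mul (‖(p : K)‖ ^ n * L)
    rw [zero_mul, mul_zero] at h
    obtain ⟨j₀, hj₀⟩ := (Metric.tendsto_atTop.1 h) ε hε
    refine ⟨j₀, fun j hj => ?_⟩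
    have := hj₀ j hj
    rw [Real.dist_eq, sub_zero, abs_of_nonneg (by positivity)] at this
    calc ‖(p : K)‖ ^ n * (L * (ρ ^ j * δ)) = ‖(p : K)‖ ^ n * L * (ρ ^ j * δ) := by ring
      _ < ε := this
  obtain ⟨j₀, hj₀⟩ := hj
  refine ⟨n + j₀, fun m hm => ?_⟩
  obtain ⟨j, rfl⟩ : ∃ j, m = n + j := ⟨m - n, by omega⟩
  have hjj : j₀ ≤ j := by omega
  rw [dist_zero_right]
  refine (norm_pow_mul_tsum_sub_pow_mul_tsum_le W G hG0 k hk hC0 hC u w hw huw n hL0 hL' j).trans_lt ?_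
  rcases le_total C (L * (ρ ^ j * δ)) with hcase | hcase
  · rw [max_eq_right hcase]; exact hj₀ j hjj
  · rw [max_eq_left hcase]; exact hnC

/-- ★★ **TRANSPORT INVARIANCE OF THE COLMEZ FUNCTIONAL.** In the situation of `tendsto_pow_mul_tsum_sub_pow_mul_tsum`, if
`pⁿ·G(wₙ) → 𝒞` (the Colmez functional of `G` along the exact tower `w`, J2 `exists_tendsto_pow_mul_tsum`), then also
**`pᵐ·G(u_m) → 𝒞`** along the `δ`-close sequence `u`. [cite: Katz1981CrystallineDieudonne, §5.1, Thm. 5.1.4] -/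
theorem tendsto_pow_mul_tsum_of_divisionSeq_norm_sub_le (W : WeierstrassCurve ℤ) (G : PowerSeries K)
    (hG0 : PowerSeries.constantCoeff G = 0) (k : ℕ) (hk : ∀ n, ‖PowerSeries.coeff n G‖ ≤ (n : ℝ) ^ k) {C : ℝ} (hC0 : 0 ≤ C)
    (hC : ∀ d : Fin 2 →₀ ℕ, ‖MvPowerSeries.coeff d (G.subst (W.map (Int.castRingHom K)).formalGroupLaw -
      G.subst (MvPowerSeries.X 0 : MvPowerSeries (Fin 2) K) - G.subst (MvPowerSeries.X 1 : MvPowerSeries (Fin 2) K))‖ ≤ C)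
    (hpK : ‖(p : K)‖ < 1) {δ : ℝ} (hδ : δ < 1) (u w : ℕ → (ballNilIdeal K).toIdeal)
    (hw : ∀ n, evalPt₁ (ballNilIdeal K) (W.formalMul p) (W.constantCoeff_formalMul p) (w (n + 1)) = w n)
    (huw : ∀ n, ‖(((w n : (ballNilIdeal K).toIdeal) : unitBall K) : K) - (((u n : (ballNilIdeal K).toIdeal) : unitBall K) : K)‖ ≤ δ)
    {𝒞 : K} (h𝒞 : Tendsto (fun m : ℕ => (p : K) ^ m * ∑' j : ℕ, PowerSeries.coeff j G *
      (((w m : (ballNilIdeal K).toIdeal) : unitBall K) : K) ^ j) atTop (𝓝 𝒞)) :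
    Tendsto (fun m : ℕ => (p : K) ^ m * ∑' j : ℕ, PowerSeries.coeff j G * (((u m : (ballNilIdeal K).toIdeal) : unitBall K) : K) ^ j)
      atTop (𝓝 𝒞) := by
  have h := (tendsto_pow_mul_tsum_sub_pow_mul_tsum W G hG0 k hk hC0 hC hpK hδ u w hw huw).add h𝒞
  rw [zero_add] at h
  exact h.congr fun m => by ring

/-- **Packaged form (J2 + J3).** For an exact `[p]_W`-tower `w` `δ`-close (`δ < 1`) to a sequence `u` and `G` of the second kind, there is ONE
limit `𝒞` (the Colmez functional of `G` along `w`) with `pᵐG(w_m) → 𝒞`, `pᵐG(u_m) → 𝒞` and the rate `‖𝒞 − pᵐG(w_m)‖ ≤ ‖p‖ᵐ·C`.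
[cite: Katz1981CrystallineDieudonne, §5.1, Key Lemma 5.1.3, Thm. 5.1.4] -/
theorem exists_tendsto_pow_mul_tsum_of_divisionSeq_norm_sub_le (W : WeierstrassCurve ℤ) (G : PowerSeries K)
    (hG0 : PowerSeries.constantCoeff G = 0) (k : ℕ) (hk : ∀ n, ‖PowerSeries.coeff n G‖ ≤ (n : ℝ) ^ k) {C : ℝ} (hC0 : 0 ≤ C)
    (hC : ∀ d : Fin 2 →₀ ℕ, ‖MvPowerSeries.coeff d (G.subst (W.map (Int.castRingHom K)).formalGroupLaw -
      G.subst (MvPowerSeries.X 0 : MvPowerSeries (Fin 2) K) - G.subst (MvPowerSeries.X 1 : MvPowerSeries (Fin 2) K))‖ ≤ C)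
    (hpK : ‖(p : K)‖ < 1) {δ : ℝ} (hδ : δ < 1) (u w : ℕ → (ballNilIdeal K).toIdeal)
    (hw : ∀ n, evalPt₁ (ballNilIdeal K) (W.formalMul p) (W.constantCoeff_formalMul p) (w (n + 1)) = w n)
    (huw : ∀ n, ‖(((w n : (ballNilIdeal K).toIdeal) : unitBall K) : K) - (((u n : (ballNilIdeal K).toIdeal) : unitBall K) : K)‖ ≤ δ) :
    ∃ 𝒞 : K,
      Tendsto (fun m : ℕ => (p : K) ^ m * ∑' j : ℕ, PowerSeries.coeff j G * (((w m : (ballNilIdeal K).toIdeal) : unitBall K) : K) ^ j)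
        atTop (𝓝 𝒞) ∧
      Tendsto (fun m : ℕ => (p : K) ^ m * ∑' j : ℕ, PowerSeries.coeff j G * (((u m : (ballNilIdeal K).toIdeal) : unitBall K) : K) ^ j)
        atTop (𝓝 𝒞) ∧
      ∀ m : ℕ, ‖𝒞 - (p : K) ^ m * ∑' j : ℕ, PowerSeries.coeff j G * (((w m : (ballNilIdeal K).toIdeal) : unitBall K) : K) ^ j‖ ≤
        ‖(p : K)‖ ^ m * C := by
  obtain ⟨𝒞, h𝒞, hrate⟩ := exists_tendsto_pow_mul_tsum W G hG0 k hk hC0 hC hp.out.one_le hpK w hw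
  exact ⟨𝒞, h𝒞, tendsto_pow_mul_tsum_of_divisionSeq_norm_sub_le W G hG0 k hk hC0 hC hpK hδ u w hw huw h𝒞, hrate⟩

end Transport

/-! ## §4 Two evaluations of the functional -/

/-- **Exact case `C = 0`** (e.g. `G = log_W`, an `F_W`-homomorphism): along an exact `[p]_W`-tower, **`pⁿ·G(wₙ) = G(w₀)`** for all `n`.
[cite: Katz1981CrystallineDieudonne, §5.1] [cite: SilvermanAEC2009, IV.6.4] -/
theorem pow_mul_tsum_divisionSeq_eq_of_cocycle_zero (W : WeierstrassCurve ℤ) (G : PowerSeries K)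
    (hG0 : PowerSeries.constantCoeff G = 0) (k : ℕ) (hk : ∀ n, ‖PowerSeries.coeff n G‖ ≤ (n : ℝ) ^ k)
    (hC : ∀ d : Fin 2 →₀ ℕ, ‖MvPowerSeries.coeff d (G.subst (W.map (Int.castRingHom K)).formalGroupLaw -
      G.subst (MvPowerSeries.X 0 : MvPowerSeries (Fin 2) K) - G.subst (MvPowerSeries.X 1 : MvPowerSeries (Fin 2) K))‖ ≤ 0)
    {p : ℕ} (hp : 1 ≤ p) (w : ℕ → (ballNilIdeal K).toIdeal)
    (hw : ∀ n, evalPt₁ (ballNilIdeal K) (W.formalMul p) (W.constantCoeff_formalMul p) (w (n + 1)) = w n) (n : ℕ) :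
    (p : K) ^ n * ∑' j : ℕ, PowerSeries.coeff j G * (((w n : (ballNilIdeal K).toIdeal) : unitBall K) : K) ^ j =
      ∑' j : ℕ, PowerSeries.coeff j G * (((w 0 : (ballNilIdeal K).toIdeal) : unitBall K) : K) ^ j := by
  have h := norm_pow_add_mul_tsum_sub_le W G hG0 k hk le_rfl hC hp w hw 0 n
  rw [zero_add, pow_zero, one_mul, mul_zero] at h
  exact sub_eq_zero.1 (norm_le_zero_iff.1 h)

omit [CompleteSpace K] in
/-- **Bounded coefficients have zero functional**: if `‖cₙ‖ ≤ B` for all `n` then `‖G(x)‖ ≤ B` on `𝔪_K`, hence for `‖p‖ < 1` and ANY sequence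
`u` of `𝔪_K`: **`pᵐ·G(u_m) → 0`**. (Applied to the bounded error term of the transported Hodge line.) [cite: Katz1981CrystallineDieudonne, §5.1] -/
theorem norm_tsum_le_of_norm_coeff_le (G : PowerSeries K) {B : ℝ} (hB0 : 0 ≤ B) (hB : ∀ n, ‖PowerSeries.coeff n G‖ ≤ B)
    (x : (ballNilIdeal K).toIdeal) :
    ‖∑' j : ℕ, PowerSeries.coeff j G * (((x : unitBall K)) : K) ^ j‖ ≤ B := by
  refine IsUltrametricDist.norm_tsum_le_of_forall_le_of_nonneg hB0 fun j => ?_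
  rw [norm_mul, norm_pow]
  calc ‖PowerSeries.coeff j G‖ * ‖((x : unitBall K) : K)‖ ^ j ≤ B * 1 :=
        mul_le_mul (hB j) (pow_le_one₀ (norm_nonneg _) (norm_lt_one_of_mem x).le) (pow_nonneg (norm_nonneg _) _) hB0
    _ = B := mul_one B

omit [CompleteSpace K] in
/-- **`pᵐ·G(u_m) → 0`** for `G` with bounded coefficients, `‖p‖ < 1`, and any sequence `u` of `𝔪_K`. [cite: Katz1981CrystallineDieudonne, §5.1] -/
theorem tendsto_pow_mul_tsum_zero_of_norm_coeff_le (G : PowerSeries K) {B : ℝ} (hB0 : 0 ≤ B) (hB : ∀ n, ‖PowerSeries.coeff n G‖ ≤ B)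
    {p : ℕ} (hpK : ‖(p : K)‖ < 1) (u : ℕ → (ballNilIdeal K).toIdeal) :
    Tendsto (fun m : ℕ => (p : K) ^ m * ∑' j : ℕ, PowerSeries.coeff j G * (((u m : (ballNilIdeal K).toIdeal) : unitBall K) : K) ^ j)
      atTop (𝓝 0) := by
  rw [tendsto_zero_iff_norm_tendsto_zero]
  have hrate : Tendsto (fun m : ℕ => ‖(p : K)‖ ^ m * B) atTop (𝓝 0) := by
    have h := (tendsto_pow_atTop_nhds_zero_of_lt_one (norm_nonneg _) hpK).mul_const B
    rwa [zero_mul] at h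
  refine squeeze_zero (fun _ => norm_nonneg _) (fun m => ?_) hrate
  rw [norm_mul, norm_pow]
  exact mul_le_mul_of_nonneg_left (norm_tsum_le_of_norm_coeff_le G hB0 hB (u m)) (pow_nonneg (norm_nonneg _) m)

end Literature.NumberTheory.EllipticCurves
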